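import Summits.QuantumFields.YangMills.Theses.ParabolicTrajectory
import Literature.MathematicalPhysics.QuantumFieldTheory.QCDTimeReflection

/-!
# `SplitChildrenS` — the three children of option γ_PVG for the RESTATED crux (S_PVG), stated with the
# ROUTE FILE's imports plus ONE Literature module (lead c12 of stmt-QuantumFields-10524, 2026-08-17)

Pre-verification for the planner's `--split TunedSequenceExistsPVG --into children-S.json` (CROSS-CRUX-S-c12.md
§3): the three statement texts of `children-S.json`, pasted verbatim inside the route namespace with the route
file's `open` lines, elaborate with `Summits.QuantumFields.YangMills.Theses.ParabolicTrajectory`'s own imports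
plus `Literature.MathematicalPhysics.QuantumFieldTheory.QCDTimeReflection` (for `cfgReflect`, the `ℤ⁴` site time
reflection; needed by the two mirror children only).  The companion `SplitReadbackS.lean` certifies that each text
is DEFINITIONALLY the landed Theorems-side name and that the `--glue-by` declaration typechecks against them.
Workfile only (planners own Theses); nothing is asserted.
-/

namespace Summit.QuantumFields.YangMills.Theses.ParabolicTrajectory.SplitChildrenS

open scoped BigOperators Topology Manifold Classical MeasureTheory ProbabilityTheory Matrix InnerProductSpace ComplexConjugate ContinuousMap
open Filter Set Function TopologicalSpace MeasureTheory

/-- Child 1 (crux) `SharpCorrelatorLowerBound` — X_P: the quantitative `ξ(β) → ∞` with canonical amplitude, in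
continuous intrinsic units, for the corner action density (≡ `UnitsCore.SharpLowerBoundAll`). -/
def SharpCorrelatorLowerBound : Prop :=
  ∀ (G : Type) [Group G] [TopologicalSpace G] [IsTopologicalGroup G] [CompactSpace G], Literature.MathematicalPhysics.QuantumFieldTheory.IsCompactSimpleLieGroup G → letI : MeasurableSpace G := borel G; haveI : BorelSpace G := ⟨rfl⟩; ∀ (r : Literature.MathematicalPhysics.QuantumFieldTheory.LatticeRep G), ∃ a : ℝ → ℝ, Continuous a ∧ (∀ β, 0 < a β) ∧ Filter.Tendsto a Filter.atTop (nhds 0) ∧ ∃ (s₁ s₂ ε β₅ Λ₅ : ℝ), 0 < s₁ ∧ s₁ ≤ s₂ ∧ 0 < ε ∧ ∀ β : ℝ, β₅ ≤ β → ∀ (L D : ℕ), Λ₅ ≤ a β * L → s₁ ≤ D * a β → D * a β ≤ s₂ → ε ≤ (D : ℝ) ^ 8 * Literature.MathematicalPhysics.QuantumFieldTheory.latticeConnectedCorr r.ρ β (2 * L + 1) r.curvature.F r.curvature.F D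

/-- Child 2 (crux) `MirrorCeilingIn` — A_in: canonical upper bound for the inward mirror correlator
(≡ `FixedAspectSplit.MirrorBoundInAll`). -/
def MirrorCeilingIn : Prop :=
  ∀ (G : Type) [Group G] [TopologicalSpace G] [IsTopologicalGroup G] [CompactSpace G], Literature.MathematicalPhysics.QuantumFieldTheory.IsCompactSimpleLieGroup G → letI : MeasurableSpace G := borel G; haveI : BorelSpace G := ⟨rfl⟩; ∀ (r : Literature.MathematicalPhysics.QuantumFieldTheory.LatticeRep G), ∃ (β₁ K : ℝ), ∀ β : ℝ, β₁ ≤ β → ∀ (L D : ℕ), D ≤ L → (D : ℝ) ^ 8 * |Literature.MathematicalPhysics.QuantumFieldTheory.latticeConnectedCorr r.ρ β (2 * L + 1) r.curvature.F (fun V => r.curvature.F (Literature.MathematicalPhysics.QuantumFieldTheory.cfgReflect V)) D| ≤ K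

/-- Child 3 (crux) `MirrorCeilingOut` — A_out: canonical upper bound for the outward mirror correlator
(≡ `FixedAspectSplit.MirrorBoundOutAll`). -/
def MirrorCeilingOut : Prop :=
  ∀ (G : Type) [Group G] [TopologicalSpace G] [IsTopologicalGroup G] [CompactSpace G], Literature.MathematicalPhysics.QuantumFieldTheory.IsCompactSimpleLieGroup G → letI : MeasurableSpace G := borel G; haveI : BorelSpace G := ⟨rfl⟩; ∀ (r : Literature.MathematicalPhysics.QuantumFieldTheory.LatticeRep G), ∃ (β₁ K : ℝ), ∀ β : ℝ, β₁ ≤ β → ∀ (L D : ℕ), D ≤ L → (D : ℝ) ^ 8 * |Literature.MathematicalPhysics.QuantumFieldTheory.latticeConnectedCorr r.ρ β (2 * L + 1) (fun V => r.curvature.F (Literature.MathematicalPhysics.QuantumFieldTheory.cfgReflect V)) r.curvature.F D| ≤ K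

/-- Parent (restated crux) `TunedSequenceExistsPVG` — banner item (b), verbatim the S_PVG text of RESTATE-B-c9.md
with Literature names fully qualified (≡ `TwoOrbitSynchronisation.TunedSequenceExistsPVG`). -/
def TunedSequenceExistsPVG : Prop :=
  ∀ (G : Type) [Group G] [TopologicalSpace G] [IsTopologicalGroup G] [CompactSpace G], Literature.MathematicalPhysics.QuantumFieldTheory.IsCompactSimpleLieGroup G → letI : MeasurableSpace G := borel G; haveI : BorelSpace G := ⟨rfl⟩; ∀ (r : Literature.MathematicalPhysics.QuantumFieldTheory.LatticeRep G) (M : ℕ), 2 ≤ M → ∃ θ₀ : ℝ, 0 < θ₀ ∧ ∀ θ : ℝ, 0 < θ → θ < θ₀ → ∃ (sch : Literature.MathematicalPhysics.QuantumFieldTheory.SpeciesScheme (Literature.MathematicalPhysics.QuantumFieldTheory.YMSpecies G)) (n : ℕ → ℕ), (∀ k, sch.a k = ((M : ℝ) ^ n k)⁻¹) ∧ Filter.Tendsto sch.β Filter.atTop Filter.atTop ∧ (∀ t : ℕ, 0 < t → ∃ c : ℝ, Filter.Tendsto (fun k => ((M : ℝ) ^ n k) ^ 8 * Literature.MathematicalPhysics.QuantumFieldTheory.latticeConnectedCorr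 r.ρ (sch.β k) (sch.side k) r.curvature.F r.curvature.F (t * M ^ n k)) Filter.atTop (nhds c)) ∧ Filter.Tendsto (fun k => ((M : ℝ) ^ n k) ^ 8 * Literature.MathematicalPhysics.QuantumFieldTheory.latticeConnectedCorr r.ρ (sch.β k) (sch.side k) r.curvature.F r.curvature.F (M ^ n k)) Filter.atTop (nhds θ) ∧ (∃ N : ℕ, 1 ≤ N ∧ ∀ᶠ k in Filter.atTop, (sch.a k)⁻¹ ≤ (sch.a k * (sch.L k : ℝ)) ^ N)

/-- The restated parent still yields the rev-7 conjunct (S) by pure logic (drop the growth clause), so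
`closes` survives the restatement even before the (A)/(B) items are edited. -/
theorem tunedSequenceExists_of_PVG : TunedSequenceExistsPVG → TunedSequenceExists := by
  intro h G _ _ _ _ hG
  letI : MeasurableSpace G := borel G
  haveI : BorelSpace G := ⟨rfl⟩
  intro r M hM
  obtain ⟨θ₀, hθ₀, hall⟩ := h G hG r M hM
  refine ⟨θ₀, hθ₀, fun θ hθ hθθ => ?_⟩
  obtain ⟨sch, n, hshape, hbeta, hconv, htune, -⟩ := hall θ hθ hθθ
  exact ⟨sch, n, hshape, hbeta, hconv, htune⟩

end Summit.QuantumFields.YangMills.Theses.ParabolicTrajectory.SplitChildrenS
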